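/-
Copyright: lit-balaban cell, Phase-2 proof seat p24 (gen 25).  Released under Apache 2.0 license as described in the
file LICENSE.
-/
import Literature.MathematicalPhysics.QuantumFieldTheory.Balaban1983to89.B4Thm110ZeroLattice

/-!
# `Balaban1983to89.B4Eq16ZeroLatticeBounded` — [Balaban1983RegularityDecay] (1.6) FOR `Ω = ηℤ^{d+1}`, `A = 0`, ON BOUNDED
# FIELDS: `G_k(0)` of [Balaban1983Higgs3] p. 433 is THE two-sided inverse of `D = −Δ^ξ + m² + a_kQ_k^*Q_k` on `ℓ^∞(ηℤ^{d+1})`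
# — `D(G_k(0)f) = f` for bounded `f`, the transpose identity `φ = G_k(0)ᵀ(Dφ)` for bounded `φ`, Liouville-type uniqueness
# (`Dφ = 0`, `φ` bounded ⟹ `φ = 0`), every `m² ≥ 0`

statement-level skeleton of published theorems with citation tags; proofs where landed; nothing here is a claim about
the Yang–Mills mass gap

v1.1 (p24 gen 26, 2026-08-25): DOCSTRING-ONLY — (1.8) is now quoted with its Neumann superscript `N` and its «for e
sufficiently small and for a regular vector field A» proviso (referee ref-4 D-g103-1); no declaration, statement or proof changed.

CITATION HEADER.  T. Bałaban, *Regularity and decay of lattice Green's functions*, Commun. Math. Phys. **89** (1983)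
571–597, doi:10.1007/bf01214744 [Balaban1983RegularityDecay] (cell paper B4; held text
`paper:balaban1983-cmp89-regularity-decay`, journal page = PDF page + 570): p. 572 [PDF 2] (1.6), p. 573 [PDF 3] (1.8) and
the Theorem with (1.10), p. 584 [PDF 14] (2.44); T. Bałaban, *(Higgs)₂,₃ quantum fields in a finite volume. III*, Commun.
Math. Phys. **88** (1983) 411–445 [Balaban1983Higgs3] (cell paper B3), p. 433 [PDF 23].  Unit `lit-balaban-p24` gen 25; HOME
`run/shared/lean/pub/lit-balaban/`; SKELETON rows **B4.Eq1.6** and **B4.Thm@573** (owner r01), **B3.Txt@433** (owner r15) —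
cells only, proved-headed; the optional item suggested by r01 g50 (seat INBOX 15:43:27Z), closing p03's honest-scope caveat
«uniqueness among bounded solutions … NOT claimed» for the lattice propagator.  Builds on `B4Thm110ZeroLattice` only.

WHAT IS PRINTED.  [B4] p. 572: «G_k(Ω, A) = (−Δ^{η,N}_{A,Ω} + m² + aP_k(A))^{−1}, (1.6) where m² ≧ 0 and a is a positive
constant».  p. 573: «The operator defining the Green's function (1.6) has a strictly positive lower bound. … This bound
justifies the definition (1.6) and explains exponential decay properties.» and the Theorem: «|(G_k(Ω,A)f)(x)| ≦
c₀exp(−δ₀dist(x, supp f))‖f‖_∞ (1.10)».  [B3] p. 433: «we substitute G_k(□,0) = G_k(0) + δG_k(□,ηZ^d,0)» — the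
infinite-lattice propagator `G_k(0)` (p03 gen 8's `B3GkZeroLattice.GkLat`, the limit of Neumann-cube propagators) applied
to the bounded ∕ finitely supported fields of the §2 expansions.

WHAT THIS MODULE PROVES (kernel-checked; theorems only; 0 `def`; 0 `sorry`; axioms standard), for every `k ≥ 1`, `a > 0`,
`m² ≥ 0` (`n = L^k`, running coefficient `a_k = B1.aSeq a L k`, `D = B4Green244.opD n a_k m²`, `G_k(0) = GkLat`, complex
fields):
* `opD_GkLat_apply_bounded` — for bounded `f`, `D(G_k(0)f) = f` on all of `ℤ^{d+1}`, `(G_k(0)f)(x) = Σ_zG_k(0)(x,z)f(z)`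
  absolutely convergent (and `‖G_k(0)f‖_∞ ≤ c₀‖f‖_∞`, `B4Thm110ZeroLattice.GkLat_apply_le`): the finite stencil of `D`
  (`B4Green242Bridge.opK_dictionary`) commutes with the series, and `DG_k(0)(·,z) = δ_z` (`opD_GkLat_col`).
* `GkLat_transpose_opD_bounded` — for bounded `φ`: `φ(x) = Σ_zG_k(0)(z,x)(Dφ)(z)` (absolutely convergent): Fubini
  (`Summable.tsum_comm'`) on the double family `G_k(0)(z,x)D(z,w)φ(w)`, absolutely summable because the columns of `G_k(0)`
  are summable (`summable_GkLat_col`, i.e. Lemma 2.2 at `p = q = 1`) and the stencil is finite and bounded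
  (`B4Reflection242.norm_opK_le`, `card_opSupp_le`), symmetric (`opK_comm`).
* `eq_zero_of_bounded_of_opD_eq_zero` (LIOUVILLE): bounded `φ` with `Dφ = 0` is `0`; `eq_GkLat_apply_of_bounded_solution`:
  every bounded solution of `Dφ = f` IS `G_k(0)f`; `bounded_solution_unique`; the summary `GkLat_inverse_linfty`
  (`G_k(0)` is the two-sided inverse of (1.6) on `ℓ^∞(ηℤ^{d+1})`, with the (1.10) operator bound).
* Non-vacuity at `d + 1 = 4`, `L = 2`, `m² = 0`.

DICTIONARY / HONEST SCOPE.  (i) `A = 0`, one component, `Ω = ηℤ^{d+1}` (no boundary), the lineage's units; `a_k > 0` is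
what makes the massless case work (the block-averaging term; (1.8) p. 573 «for e sufficiently small and for a regular vector
field A  −Δ^{η,N}_{A,Ω} + aP_k(A) ≧ γ₀I» — both provisos vacuous at `A = 0`), but NO spectral bound is
used here — only the decay (1.10) of `G_k(0)` (row and column summability) and the Green identity.  (ii) "Bounded" is the
hypothesis `‖φ(z)‖ ≤ Φ` for all `z`; growth conditions weaker than boundedness (e.g. `e^{δ|z|/n}`, `δ < δ₀`) are NOT treated.
(iii) The existence half (`D(G_k(0)f) = f`, the bound `c₀‖f‖_∞`) is (1.6) + (1.10) read for `Ω = ηℤ^{d+1}`; the uniqueness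
half (transpose identity, Liouville) is NOT a printed sentence — it is our remark making (1.6) an operator identity on bounded
fields, exactly as the `ℓ²` uniqueness of `B4Thm110ZeroLattice.eq_GkLat_col_of_opD_eq` ∕ `B4Ineq227LatticeL2` did for
square-summable fields (neither class contains the other on an infinite lattice; both identify the same kernel).  (iv) Value = the inverse
statement (1.6) for the free infinite-lattice propagator on the class of fields [B3] applies it to; cells only; NOT summit
progress.
-/

namespace Literature.MathematicalPhysics.QuantumFieldTheory.Balaban1983to89.B4Eq16ZeroLatticeBounded

open Finset Filter Topology Complex
open Literature.MathematicalPhysics.QuantumFieldTheory.Balaban1983to89.B4ContourShift (supNorm supNorm_nonneg)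
open Literature.MathematicalPhysics.QuantumFieldTheory.Balaban1983to89.B4Reflection242 (opK opSupp opK_comm mem_opSupp_comm
  opK_eq_zero_of_not_mem norm_opK_le)
open Literature.MathematicalPhysics.QuantumFieldTheory.Balaban1983to89.B3GkZeroLattice (GkLat GkLat_comm)
open Literature.MathematicalPhysics.QuantumFieldTheory.Balaban1983to89.B4Green244 (opD)
open Literature.MathematicalPhysics.QuantumFieldTheory.Balaban1983to89.B4Green242Bridge (opK_dictionary)
open Literature.MathematicalPhysics.QuantumFieldTheory.Balaban1983to89.B4Thm110ZeroBox (one_lt_L_real)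
open Literature.MathematicalPhysics.QuantumFieldTheory.Balaban1983to89.B4Thm110ZeroLattice

noncomputable section

variable {d : ℕ}

/-! ## §0 Kernel helpers -/

/-- kernel: `L^k ≥ 1`. [folklore] -/
private theorem one_le_n (ℓ k : ℕ) : 1 ≤ (ℓ + 1) ^ k := Nat.one_le_pow _ _ (by omega)

section Bounded

variable {ℓ k : ℕ} {a m2 : ℝ}

/-- kernel: the rows of `G_k(0)` against a bounded datum are absolutely summable, with `‖(G_k(0)f)(x)‖ ≤ c₀F_∞` for the
window constant `c₀` of `GkLat_weightedRow_le` (the `D = 0` instance of `B4Thm110ZeroLattice.GkLat_apply_le`).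
[cite: Balaban1983RegularityDecay, Theorem (1.10) p.573; dictionary (Ω = ηℤ^{d+1}, A = 0)] -/
private theorem row_apply_bounded (hℓ : 1 ≤ ℓ) (hk : 1 ≤ k) (ha : 0 < a) (hm : 0 ≤ m2) :
    ∃ c₀ : ℝ, 0 < c₀ ∧ ∀ {f : (Fin (d + 1) → ℤ) → ℂ} {Fsup : ℝ}, (∀ z, ‖f z‖ ≤ Fsup) → ∀ x,
      (Summable fun z => ((GkLat ℓ k a m2 x z : ℝ) : ℂ) * f z) ∧
        ‖∑' z, ((GkLat ℓ k a m2 x z : ℝ) : ℂ) * f z‖ ≤ c₀ * Fsup := by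
  obtain ⟨δ₀, c₀, hδ₀, hc₀, h⟩ := GkLat_weightedRow_le d ℓ hℓ a a m2 ha
  refine ⟨c₀, hc₀, fun hf x => ?_⟩
  have hb := GkLat_apply_le (D := 0) hδ₀.le (h k hk a m2 le_rfl le_rfl hm le_rfl x) hf
    (fun z _ => supNorm_nonneg (x - z))
  simpa only [mul_zero, zero_div, neg_zero, Real.exp_zero, mul_one] using hb

/-- **`G_k(0)` INVERTS `D = −Δ^ξ + m² + a_kQ_k^*Q_k` ON BOUNDED FIELDS**: for every bounded `f : ηℤ^{d+1} → ℂ` the field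
`φ = G_k(0)f`, `φ(x) = Σ_z G_k(0)(x,z)f(z)` (absolutely convergent, bounded by `c₀‖f‖_∞`), satisfies `Dφ = f` on the whole
lattice — «G_k(Ω, A) = (−Δ^{η,N}_{A,Ω} + m² + aP_k(A))^{−1} (1.6)» for `Ω = ηℤ^{d+1}`, `A = 0`, on `ℓ^∞`: the finite stencil of
`D` (`B4Green242Bridge.opK_dictionary`) commutes with the convergent series and `DG_k(0)(·,z) = δ_z`
(`B4Thm110ZeroLattice.opD_GkLat_col`). [cite: Balaban1983RegularityDecay, (1.6) p.572 with Theorem (1.10) p.573; Balaban1983Higgs3, p.433 («we substitute G_k(□,0) = G_k(0) + δG_k(□,ηZ^d,0)»); dictionary (Ω = ηℤ^{d+1}, A = 0)] -/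
theorem opD_GkLat_apply_bounded (hℓ : 1 ≤ ℓ) (hk : 1 ≤ k) (ha : 0 < a) (hm : 0 ≤ m2)
    {f : (Fin (d + 1) → ℤ) → ℂ} {Fsup : ℝ} (hf : ∀ z, ‖f z‖ ≤ Fsup) (x : Fin (d + 1) → ℤ) :
    opD ((ℓ + 1) ^ k) (B1.aSeq a ((ℓ : ℝ) + 1) k) m2
      (fun w => ∑' z, ((GkLat ℓ k a m2 w z : ℝ) : ℂ) * f z) x = f x := by
  classical
  haveI : NeZero ((ℓ + 1) ^ k) := ⟨pow_ne_zero _ (Nat.succ_ne_zero ℓ)⟩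
  obtain ⟨c₀, -, hrow⟩ := row_apply_bounded (d := d) hℓ hk ha hm
  have hsum : ∀ w, Summable fun z => ((GkLat ℓ k a m2 w z : ℝ) : ℂ) * f z := fun w => (hrow hf w).1
  set n : ℕ := (ℓ + 1) ^ k with hn
  set K : (Fin (d + 1) → ℤ) → (Fin (d + 1) → ℤ) → ℂ :=
    opK (((n : ℕ) : ℂ) ^ 2) (m2 : ℂ) (((B1.aSeq a ((ℓ : ℝ) + 1) k : ℝ) : ℂ) * (((n : ℕ) : ℂ) ^ (d + 1))⁻¹) n with hK
  -- `D` as the finite stencil `Σ_{w ∈ opSupp x} K(x,w)φ(w)`, exchanged with the convergent series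
  rw [← opK_dictionary n (one_le_n ℓ k)]
  have hswap : ∑ w ∈ opSupp n x, K x w * ∑' z, ((GkLat ℓ k a m2 w z : ℝ) : ℂ) * f z
      = ∑' z, ∑ w ∈ opSupp n x, K x w * (((GkLat ℓ k a m2 w z : ℝ) : ℂ) * f z) := by
    rw [(hasSum_sum fun w _ => ((hsum w).hasSum.mul_left (K x w))).tsum_eq]
  rw [hswap]
  -- the inner stencil sum is `(DG_k(0)(·,z))(x)·f(z) = δ_z(x)f(z)`
  have hinner : ∀ z, ∑ w ∈ opSupp n x, K x w * (((GkLat ℓ k a m2 w z : ℝ) : ℂ) * f z)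
      = (if x = z then 1 else 0) * f z := by
    intro z
    simp_rw [← mul_assoc]
    rw [← Finset.sum_mul, hK, hn, opK_dictionary ((ℓ + 1) ^ k) (one_le_n ℓ k), opD_GkLat_col hℓ hk ha hm z x]
  simp_rw [hinner]
  rw [tsum_eq_single x (fun z hz => by rw [if_neg (Ne.symm hz), zero_mul])]
  rw [if_pos rfl, one_mul]

/-- **THE TRANSPOSE IDENTITY FOR BOUNDED FIELDS**: for every bounded `φ : ηℤ^{d+1} → ℂ` and every point `x`,
`φ(x) = Σ_z G_k(0)(z,x)·(Dφ)(z)`, the series converging absolutely — Fubini on the absolutely convergent double series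
`Σ_z Σ_{w ∈ supp D(z,·)} G_k(0)(z,x)D(z,w)φ(w)` (columns of `G_k(0)` summable: `GkLat_weightedCol_le`; the stencil of `D` is
finite, bounded and symmetric: `B4Reflection242.opK_comm`), then `Σ_z D(w,z)G_k(0)(z,x) = δ_x(w)` (`opD_GkLat_col`).
[cite: Balaban1983RegularityDecay, (1.6) p.572, Theorem (1.10) p.573, (2.44) p.584; dictionary (Ω = ηℤ^{d+1}, A = 0)] -/
theorem GkLat_transpose_opD_bounded (hℓ : 1 ≤ ℓ) (hk : 1 ≤ k) (ha : 0 < a) (hm : 0 ≤ m2)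
    {φ : (Fin (d + 1) → ℤ) → ℂ} {Φ : ℝ} (hφ : ∀ z, ‖φ z‖ ≤ Φ) (x : Fin (d + 1) → ℤ) :
    (Summable fun z => ((GkLat ℓ k a m2 z x : ℝ) : ℂ) * opD ((ℓ + 1) ^ k) (B1.aSeq a ((ℓ : ℝ) + 1) k) m2 φ z) ∧
      ∑' z, ((GkLat ℓ k a m2 z x : ℝ) : ℂ) * opD ((ℓ + 1) ^ k) (B1.aSeq a ((ℓ : ℝ) + 1) k) m2 φ z = φ x := by
  classical
  haveI : NeZero ((ℓ + 1) ^ k) := ⟨pow_ne_zero _ (Nat.succ_ne_zero ℓ)⟩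
  have hn1 := one_le_n ℓ k
  set n : ℕ := (ℓ + 1) ^ k with hn
  set A : ℝ := B1.aSeq a ((ℓ : ℝ) + 1) k with hA
  set K : (Fin (d + 1) → ℤ) → (Fin (d + 1) → ℤ) → ℂ :=
    opK (((n : ℕ) : ℂ) ^ 2) (m2 : ℂ) (((A : ℝ) : ℂ) * (((n : ℕ) : ℂ) ^ (d + 1))⁻¹) n with hK
  have hΦ : 0 ≤ Φ := (norm_nonneg _).trans (hφ x)
  -- a uniform bound on the stencil entries
  obtain ⟨Kmax, hKmax0, hKmax⟩ : ∃ Kmax : ℝ, 0 ≤ Kmax ∧ ∀ z w, ‖K z w‖ ≤ Kmax :=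
    ⟨_, le_trans (norm_nonneg _) (norm_opK_le n _ _ _ x x), fun z w => norm_opK_le n _ _ _ z w⟩
  -- the double family `F(z,w) = G(z,x)K(z,w)φ(w)` (the stencil vanishes off `opSupp z`)
  set F : (Fin (d + 1) → ℤ) → (Fin (d + 1) → ℤ) → ℂ := fun z w => ((GkLat ℓ k a m2 z x : ℝ) : ℂ) * (K z w * φ w)
    with hF
  have hFzero : ∀ z w, w ∉ opSupp n z → F z w = 0 := fun z w hw => by
    rw [hF]; simp only [hK, opK_eq_zero_of_not_mem hn1 _ _ _ hw, zero_mul, mul_zero]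
  -- column summability of `G_k(0)`
  have hcol : Summable fun z => ‖((GkLat ℓ k a m2 z x : ℝ) : ℂ)‖ := summable_GkLat_col hℓ hk ha hm x
  -- (1) each `F(z,·)` is finitely supported; (2) each `F(·,w)` is finitely supported
  have h1 : ∀ z, Summable (F z) := fun z => summable_of_ne_finset_zero (s := opSupp n z) fun w hw => hFzero z w hw
  have h2 : ∀ w, Summable fun z => F z w := fun w =>
    summable_of_ne_finset_zero (s := opSupp n w) fun z hz => hFzero z w fun h => hz ((mem_opSupp_comm hn1).1 h)
  -- (3) absolute summability of the double family
  have hnorm_row : ∀ z, ∑' w, ‖F z w‖ ≤ ‖((GkLat ℓ k a m2 z x : ℝ) : ℂ)‖ * (Kmax * Φ * (opSupp n z).card) := by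
    intro z
    rw [tsum_eq_sum (s := opSupp n z) (fun w hw => by rw [hFzero z w hw, norm_zero])]
    calc ∑ w ∈ opSupp n z, ‖F z w‖
        ≤ ∑ w ∈ opSupp n z, ‖((GkLat ℓ k a m2 z x : ℝ) : ℂ)‖ * (Kmax * Φ) := Finset.sum_le_sum fun w _ => by
          rw [hF, norm_mul, norm_mul]
          exact mul_le_mul_of_nonneg_left (mul_le_mul (hKmax z w) (hφ w) (norm_nonneg _) hKmax0) (norm_nonneg _)
      _ = ‖((GkLat ℓ k a m2 z x : ℝ) : ℂ)‖ * (Kmax * Φ * (opSupp n z).card) := by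
          rw [Finset.sum_const, nsmul_eq_mul]; ring
  have hcard : ∀ z, ((opSupp n z).card : ℝ) ≤ (2 * (d + 1) + 1 + n ^ (d + 1) : ℕ) := fun z => by
    exact_mod_cast B4Reflection242.card_opSupp_le z
  have hU : Summable (Function.uncurry F) := by
    refine Summable.of_norm ?_
    rw [show (fun p : (Fin (d + 1) → ℤ) × (Fin (d + 1) → ℤ) => ‖Function.uncurry F p‖)
      = fun p => ‖F p.1 p.2‖ from rfl]
    refine (summable_prod_of_nonneg fun _ => norm_nonneg _).2 ⟨fun z => (h1 z).norm, ?_⟩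
    refine Summable.of_nonneg_of_le (fun z => tsum_nonneg fun _ => norm_nonneg _)
      (fun z => (hnorm_row z).trans (mul_le_mul_of_nonneg_left
        (mul_le_mul_of_nonneg_left (hcard z) (mul_nonneg hKmax0 hΦ)) (norm_nonneg _))) ?_
    exact hcol.mul_right _
  -- the two iterated sums
  have hzw : ∀ z, ∑' w, F z w = ((GkLat ℓ k a m2 z x : ℝ) : ℂ) * opD n A m2 φ z := by
    intro z
    rw [tsum_eq_sum (s := opSupp n z) (fun w hw => hFzero z w hw), hF]
    simp only []
    rw [← Finset.mul_sum, hK, opK_dictionary n hn1]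
  have hwz : ∀ w, ∑' z, F z w = (if w = x then 1 else 0) * φ w := by
    intro w
    rw [tsum_eq_sum (s := opSupp n w) (fun z hz => hFzero z w fun h => hz ((mem_opSupp_comm hn1).1 h))]
    have : ∀ z ∈ opSupp n w, F z w = K w z * ((GkLat ℓ k a m2 z x : ℝ) : ℂ) * φ w := fun z _ => by
      rw [hF]; simp only [hK]; rw [opK_comm]; ring
    rw [Finset.sum_congr rfl this, ← Finset.sum_mul, hK, opK_dictionary n hn1, hn, hA, opD_GkLat_col hℓ hk ha hm x w]
  have hcomm : ∑' z, ∑' w, F z w = ∑' w, ∑' z, F z w := (hU.tsum_comm' h1 h2).symm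
  have hs : Summable fun z => ((GkLat ℓ k a m2 z x : ℝ) : ℂ) * opD n A m2 φ z := by
    have := hU.prod  -- `z ↦ Σ'_w F z w` summable
    exact this.congr hzw
  refine ⟨hs, ?_⟩
  calc ∑' z, ((GkLat ℓ k a m2 z x : ℝ) : ℂ) * opD n A m2 φ z = ∑' z, ∑' w, F z w := by simp_rw [hzw]
    _ = ∑' w, ∑' z, F z w := hcomm
    _ = ∑' w, (if w = x then 1 else 0) * φ w := by simp_rw [hwz]
    _ = φ x := by
        rw [tsum_eq_single x (fun w hw => by rw [if_neg hw, zero_mul]), if_pos rfl, one_mul]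

/-- **LIOUVILLE-TYPE UNIQUENESS ON `ℓ^∞`**: a bounded field `φ` on `ηℤ^{d+1}` with `Dφ = 0` (`D = −Δ^ξ + m² + a_kQ_k^*Q_k`,
`a_k > 0`, every `m² ≥ 0`, the massless case included) vanishes identically — by the transpose identity.  NOT a printed
sentence: this is the uniqueness half of reading (1.6) as an operator identity on bounded fields (ours, in service of the
dictionary `Ω = ηℤ^{d+1}`), as the `ℓ²` uniqueness of `B4Thm110ZeroLattice` was for square-summable fields.
[cite: Balaban1983RegularityDecay, (1.6) p.572, (1.8) p.573 («This bound justifies the definition (1.6)»); dictionary (Ω = ηℤ^{d+1}, A = 0; uniqueness remark ours)] -/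
theorem eq_zero_of_bounded_of_opD_eq_zero (hℓ : 1 ≤ ℓ) (hk : 1 ≤ k) (ha : 0 < a) (hm : 0 ≤ m2)
    {φ : (Fin (d + 1) → ℤ) → ℂ} {Φ : ℝ} (hφ : ∀ z, ‖φ z‖ ≤ Φ)
    (h0 : ∀ z, opD ((ℓ + 1) ^ k) (B1.aSeq a ((ℓ : ℝ) + 1) k) m2 φ z = 0) : φ = 0 := by
  funext x
  have h := (GkLat_transpose_opD_bounded hℓ hk ha hm hφ x).2
  simp_rw [h0, mul_zero, tsum_zero] at h
  exact h.symm

/-- **EVERY BOUNDED SOLUTION OF `Dφ = f` IS `G_k(0)f`**: if `φ` is bounded and `Dφ = f` on `ηℤ^{d+1}` then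
`φ(x) = Σ_z G_k(0)(x,z)f(z)` for every `x` (the series converging absolutely) — `G_k(0)` of [Balaban1983Higgs3] p. 433 IS the
operator (1.6) on the bounded fields (hence on the finitely supported ones) to which it is applied there; no `ℓ²` hypothesis,
every `m² ≥ 0`. [cite: Balaban1983RegularityDecay, (1.6) p.572; Balaban1983Higgs3, p.433; dictionary (Ω = ηℤ^{d+1}, A = 0)] -/
theorem eq_GkLat_apply_of_bounded_solution (hℓ : 1 ≤ ℓ) (hk : 1 ≤ k) (ha : 0 < a) (hm : 0 ≤ m2)
    {φ f : (Fin (d + 1) → ℤ) → ℂ} {Φ : ℝ} (hφ : ∀ z, ‖φ z‖ ≤ Φ)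
    (hDφ : ∀ z, opD ((ℓ + 1) ^ k) (B1.aSeq a ((ℓ : ℝ) + 1) k) m2 φ z = f z) (x : Fin (d + 1) → ℤ) :
    (Summable fun z => ((GkLat ℓ k a m2 x z : ℝ) : ℂ) * f z) ∧
      φ x = ∑' z, ((GkLat ℓ k a m2 x z : ℝ) : ℂ) * f z := by
  obtain ⟨hs, h⟩ := GkLat_transpose_opD_bounded hℓ hk ha hm hφ x
  simp_rw [hDφ, GkLat_comm _ x] at hs h
  exact ⟨hs, h.symm⟩

/-- **UNIQUENESS OF THE BOUNDED INVERSE**: two bounded fields with the same image under `D` coincide.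
[cite: Balaban1983RegularityDecay, (1.6) p.572, (1.8) p.573; dictionary (Ω = ηℤ^{d+1}, A = 0)] -/
theorem bounded_solution_unique (hℓ : 1 ≤ ℓ) (hk : 1 ≤ k) (ha : 0 < a) (hm : 0 ≤ m2)
    {φ ψ : (Fin (d + 1) → ℤ) → ℂ} {Φ Ψ : ℝ} (hφ : ∀ z, ‖φ z‖ ≤ Φ) (hψ : ∀ z, ‖ψ z‖ ≤ Ψ)
    (hD : ∀ z, opD ((ℓ + 1) ^ k) (B1.aSeq a ((ℓ : ℝ) + 1) k) m2 φ z
      = opD ((ℓ + 1) ^ k) (B1.aSeq a ((ℓ : ℝ) + 1) k) m2 ψ z) : φ = ψ := by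
  funext x
  rw [(eq_GkLat_apply_of_bounded_solution hℓ hk ha hm hφ hD x).2,
    (eq_GkLat_apply_of_bounded_solution hℓ hk ha hm hψ (fun _ => rfl) x).2]

/-- **`G_k(0)` IS THE TWO-SIDED INVERSE OF (1.6) ON `ℓ^∞(ηℤ^{d+1})`** (summary): for bounded `f`, `G_k(0)f` is bounded
(`‖G_k(0)f‖_∞ ≤ c₀‖f‖_∞`), solves `D(G_k(0)f) = f`, and is the ONLY bounded solution.
[cite: Balaban1983RegularityDecay, (1.6) p.572, (1.8)/(1.10) p.573; Balaban1983Higgs3, p.433; dictionary (Ω = ηℤ^{d+1}, A = 0)] -/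
theorem GkLat_inverse_linfty (hℓ : 1 ≤ ℓ) (hk : 1 ≤ k) (ha : 0 < a) (hm : 0 ≤ m2) :
    ∃ c₀ : ℝ, 0 < c₀ ∧ ∀ (f : (Fin (d + 1) → ℤ) → ℂ) (Fsup : ℝ), (∀ z, ‖f z‖ ≤ Fsup) →
      (∀ x, Summable fun z => ((GkLat ℓ k a m2 x z : ℝ) : ℂ) * f z) ∧
      (∀ x, ‖∑' z, ((GkLat ℓ k a m2 x z : ℝ) : ℂ) * f z‖ ≤ c₀ * Fsup) ∧
      (∀ x, opD ((ℓ + 1) ^ k) (B1.aSeq a ((ℓ : ℝ) + 1) k) m2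
        (fun w => ∑' z, ((GkLat ℓ k a m2 w z : ℝ) : ℂ) * f z) x = f x) ∧
      ∀ (φ : (Fin (d + 1) → ℤ) → ℂ) (Φ : ℝ), (∀ z, ‖φ z‖ ≤ Φ) →
        (∀ z, opD ((ℓ + 1) ^ k) (B1.aSeq a ((ℓ : ℝ) + 1) k) m2 φ z = f z) →
          ∀ x, φ x = ∑' z, ((GkLat ℓ k a m2 x z : ℝ) : ℂ) * f z := by
  obtain ⟨c₀, hc₀, hrow⟩ := row_apply_bounded (d := d) hℓ hk ha hm
  exact ⟨c₀, hc₀, fun f Fsup hf => ⟨fun x => (hrow hf x).1, fun x => (hrow hf x).2,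
    fun x => opD_GkLat_apply_bounded hℓ hk ha hm hf x,
    fun φ Φ hφ hDφ x => (eq_GkLat_apply_of_bounded_solution hℓ hk ha hm hφ hDφ x).2⟩⟩

end Bounded

/-! ## Non-vacuity (`d + 1 = 4`, `L = 2`, `k = 1`, `a = 1`, `m² = 0`: the massless case is covered) -/

/-- the Liouville statement at the physical dimension, massless. -/
example {φ : (Fin (3 + 1) → ℤ) → ℂ} {Φ : ℝ} (hφ : ∀ z, ‖φ z‖ ≤ Φ)
    (h0 : ∀ z, opD ((1 + 1) ^ 1) (B1.aSeq 1 ((1 : ℕ) + 1 : ℝ) 1) 0 φ z = 0) : φ = 0 :=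
  eq_zero_of_bounded_of_opD_eq_zero (d := 3) le_rfl le_rfl one_pos le_rfl hφ h0

/-- the hypotheses are inhabited (`φ ≡ 0` is bounded by `0` and `D0 = 0`). -/
example : (∀ z : Fin (3 + 1) → ℤ, ‖(0 : (Fin (3 + 1) → ℤ) → ℂ) z‖ ≤ 0) ∧
    ∀ z, opD ((1 + 1) ^ 1) (B1.aSeq 1 ((1 : ℕ) + 1 : ℝ) 1) 0 (0 : (Fin (3 + 1) → ℤ) → ℂ) z = 0 :=
  ⟨fun z => by simp, fun z => by simp [opD, B4Green244.negLap, B4Green244.blockAvg]⟩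

end

end Literature.MathematicalPhysics.QuantumFieldTheory.Balaban1983to89.B4Eq16ZeroLatticeBounded
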